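import Literature.NumberTheory.EllipticCurves.WeilPairingProofs
import Literature.NumberTheory.EllipticCurves.TorsionStructureProofs
import Literature.NumberTheory.EllipticCurves.ZpExtensionProofs
import Literature.NumberTheory.EllipticCurves.SelmerGaloisAction
import HarnessLib

/-!
# Weil-type pairings on `E[n](K̄)` are semilinear under every lift of an automorphism of `K`

Route `SemiOrdinaryEisensteinDescent` (BSD, rung W-ALL row 2·3@3), Kolyvagin column, print item
`CasselsTateLevelInputsFact` (stmt-20191 ⊂ 25896): the last input of conjunct (v) of
`Literature.NumberTheory.EllipticCurves.casselsTate_levelInputs` for THE canonical invariant maps. That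
fact quantifies over EVERY biadditive alternating `μ_n`-valued pairing `e` on `E[n](K̄)` (`E = W/ℚ`, only
`Γ_K`-equivariance displayed); the transport of Milne's Cassels–Tate recipe along `σ ∈ Aut(K/ℚ)`
(`exists_semilinearTransport`) needs `e(τS, τT) = τ(e(S, T))` for the lifts `τ` of `σ` to `K̄`. This holds
for every such `e`:

* `weilType_semilinear` — **`e(τS, τT) = τ(e(S, T))`** for every lift `τ` of every `σ ∈ Aut(K/ℚ)` and
  every biadditive alternating `μ_n`-valued `e`: the Weil pairing of `W` over `ℚ̄` (`exists_weilPairing_holds`,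
  Silverman III.8.1, `Γ_ℚ`-equivariant, non-degenerate) is carried to `K̄ = AlgebraicClosure K` along the
  tree's `absClosureEquiv ℚ K : ℚ̄ ≃ₐ[ℚ] K̄`, where every `ℚ`-automorphism of `K̄` acts through `Γ_ℚ`, so the
  transported pairing `ẽ` is semilinear; on a frame `P, Q` of `E[n](K̄) ≅ (ℤ/n)²` one has
  `e(aP + cQ, bP + dQ) · ζ^{bc} = ζ^{ad}` (`ζ = e(P, Q)`, `pair_coord`) for every alternating `e`, and
  `ẽ(P, Q)` is a PRIMITIVE `n`-th root of unity, so `e = ẽ^u` — powers inherit the semilinearity.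

Equivalently: `det ρ_{E,n} = χ_n` on `Aut(K̄/ℚ)` (Silverman, CSS Ch. II §7). No named fact, no
definition; BSD is not advanced.

## References

* [SilvermanAEC2009] J. H. Silverman, *The Arithmetic of Elliptic Curves*, 2nd ed. (2009), Prop. III.8.1,
  Cor. III.6.4(b).
* [SilvermanCSS1997] J. H. Silverman, in Cornell–Silverman–Stevens (1997), Ch. II §7 (`det ρ̄_m = χ_m`).
* [GrossLMS1991] B. H. Gross, *Kolyvagin's work on modular elliptic curves* (1991), §5 (5.1).
-/

noncomputable section

open scoped Classical

-- the Theorems namespace of this sub repeats the summit name by design (D-0017 nested layout)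
set_option linter.dupNamespace false
set_option autoImplicit false

universe u

namespace Summit.BirchSwinnertonDyer.BirchSwinnertonDyer.Theorems.CasselsTateConj

open _root_.WeierstrassCurve Field Function
open Literature.NumberTheory.EllipticCurves Literature.NumberTheory.GaloisRepresentations

/-! ## Alternating biadditive pairings on a frame -/

section Frame

variable {M : Type*} [AddCommGroup M] {L : Type*} [Field L] (f : M → M → L)

/-- `f (a • S) T = f S T ^ a` for a pairing additive in the first variable with non-zero values. [folklore] -/
private theorem pair_nsmul_left (hadd₁ : ∀ S₁ S₂ T, f (S₁ + S₂) T = f S₁ T * f S₂ T) (hne : ∀ S T, f S T ≠ 0)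
    (a : ℕ) (S T : M) : f (a • S) T = f S T ^ a := by
  have h0 : f 0 T = 1 := by
    have h := hadd₁ 0 0 T
    rw [add_zero] at h
    exact (mul_eq_left₀ (hne 0 T)).mp h.symm
  induction a with
  | zero => rw [zero_nsmul, pow_zero, h0]
  | succ a ih => rw [succ_nsmul, hadd₁, ih, pow_succ]

/-- `f S (a • T) = f S T ^ a` for a pairing additive in the second variable with non-zero values. [folklore] -/
private theorem pair_nsmul_right (hadd₂ : ∀ S T₁ T₂, f S (T₁ + T₂) = f S T₁ * f S T₂) (hne : ∀ S T, f S T ≠ 0)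
    (a : ℕ) (S T : M) : f S (a • T) = f S T ^ a := by
  have h0 : f S 0 = 1 := by
    have h := hadd₂ S 0 0
    rw [add_zero] at h
    exact (mul_eq_left₀ (hne S 0)).mp h.symm
  induction a with
  | zero => rw [zero_nsmul, pow_zero, h0]
  | succ a ih => rw [succ_nsmul, hadd₂, ih, pow_succ]

/-- **An alternating biadditive pairing in coordinates**: on `aP + cQ`, `bP + dQ` it is `ζ^{ad - bc}`,
`ζ = f(P, Q)` — written without subtraction as `f(aP + cQ, bP + dQ) · ζ^{bc} = ζ^{ad}`.
[cite: SilvermanCSS1997, Ch. II §7] -/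
private theorem pair_coord (hadd₁ : ∀ S₁ S₂ T, f (S₁ + S₂) T = f S₁ T * f S₂ T)
    (hadd₂ : ∀ S T₁ T₂, f S (T₁ + T₂) = f S T₁ * f S T₂) (hne : ∀ S T, f S T ≠ 0) (halt : ∀ T, f T T = 1)
    (P Q : M) (a b c d : ℕ) :
    f (a • P + c • Q) (b • P + d • Q) * f P Q ^ (b * c) = f P Q ^ (a * d) := by
  have hζinv : f P Q * f Q P = 1 := by
    have h := halt (P + Q)
    rw [hadd₁, hadd₂, hadd₂, halt P, halt Q, one_mul, mul_one] at h
    exact h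
  rw [hadd₁, pair_nsmul_left f hadd₁ hne, pair_nsmul_left f hadd₁ hne, hadd₂, hadd₂,
    pair_nsmul_right f hadd₂ hne, pair_nsmul_right f hadd₂ hne, pair_nsmul_right f hadd₂ hne,
    pair_nsmul_right f hadd₂ hne, halt P, halt Q]
  simp only [one_pow, one_mul, mul_one, ← pow_mul]
  rw [mul_assoc, ← mul_pow, mul_comm (f Q P) (f P Q), hζinv, one_pow, mul_one, mul_comm d a]

end Frame

/-! ## The Weil pairing of `E/ℚ` transported to `K̄`, and the semilinearity of Weil-type pairings -/

section Semilinear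

variable {K : Type u} [Field K] [CharZero K] [Algebra.IsAlgebraic ℚ K] (W : WeierstrassCurve ℚ) [W.IsElliptic]
  (n : ℕ) [NeZero n]

/-- **Every biadditive alternating `μ_n`-valued pairing `e` on `E[n](K̄)` is semilinear under every lift
`τ` of every `σ ∈ Aut(K/ℚ)`: `e(τS, τT) = τ(e(S, T))`.** Proof: transport the Weil pairing `ẽ` of `W` over
`ℚ̄` (`exists_weilPairing_holds`: biadditive, alternating, non-degenerate, `Γ_ℚ`-equivariant) to `K̄` along
`j = absClosureEquiv ℚ K`; `τ` acts on the transported pairing through `j⁻¹ τ j ∈ Γ_ℚ`, so it is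
`τ`-semilinear; on a frame `P, Q` of `E[n](K̄) ≅ (ℤ/n)²` its value `ζ̃ = ẽ(P, Q)` is a primitive `n`-th root of
unity (non-degeneracy), so `e(P, Q) = ζ̃^u` and then `e = ẽ^u` everywhere
(`e(aP + cQ, bP + dQ) ζ^{bc} = ζ^{ad}` for both pairings); powers of a semilinear pairing are semilinear.
(`2 ≤ n`; the `Γ_K`-equivariance of `e` is not even needed.) [cite: SilvermanAEC2009, Prop. III.8.1]
[cite: SilvermanCSS1997, Ch. II §7] [cite: GrossLMS1991, §5 (5.1)] -/
theorem weilType_semilinear (hn : 2 ≤ n)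
    (e : geomTorsion (W.baseChange K) (n : ℤ) → geomTorsion (W.baseChange K) (n : ℤ) → (AlgebraicClosure K))
    (hμ : ∀ S T, e S T ^ n = 1) (hadd₁ : ∀ S₁ S₂ T, e (S₁ + S₂) T = e S₁ T * e S₂ T)
    (hadd₂ : ∀ S T₁ T₂, e S (T₁ + T₂) = e S T₁ * e S T₂) (halt : ∀ T, e T T = 1)
    {σ : K ≃ₐ[ℚ] K} {τ : (AlgebraicClosure K) ≃+* (AlgebraicClosure K)} (hτ : IsLiftOfAut σ τ)
    (S T : geomTorsion (W.baseChange K) (n : ℤ)) :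
    e (hτ.torsionMap W (n : ℤ) S) (hτ.torsionMap W (n : ℤ) T) = τ (e S T) := by
  have hn0 : n ≠ 0 := by omega
  -- the Weil pairing of `W` over `ℚ̄`
  obtain ⟨w, hwμ, hwadd₁, hwadd₂, hwalt, hwnd, hwgal⟩ :=
    exists_weilPairing_holds W n hn (by exact_mod_cast hn0 : ((n : ℕ) : ℚ) ≠ 0)
  -- transport of points along `j : ℚ̄ ≃ K̄` and back
  let j : (AlgebraicClosure ℚ) ≃ₐ[ℚ] (AlgebraicClosure K) := absClosureEquiv ℚ K
  let φ' : geomPoints (W.baseChange K) →+ geomPoints W :=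
    WeierstrassCurve.Affine.Point.map (W' := W) (j.symm : (AlgebraicClosure K) →ₐ[ℚ] (AlgebraicClosure ℚ))
  have hφ'mem : ∀ S : geomTorsion (W.baseChange K) (n : ℤ), φ' (S : geomPoints (W.baseChange K)) ∈
      geomTorsion W (n : ℤ) := fun S => by
    rw [mem_geomTorsion_iff, ← map_zsmul, (mem_geomTorsion_iff _ _ _).1 S.2, map_zero]
  let ψ : geomTorsion (W.baseChange K) (n : ℤ) → geomTorsion W (n : ℤ) := fun S => ⟨φ' S, hφ'mem S⟩
  have hψadd : ∀ S T, ψ (S + T) = ψ S + ψ T := fun S T => Subtype.ext (map_add φ' _ _)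
  have hψzero : ∀ S, ψ S = 0 → S = 0 := fun S hS => by
    have h : φ' (S : geomPoints (W.baseChange K)) = 0 := congrArg Subtype.val hS
    apply Subtype.ext
    change (S : geomPoints (W.baseChange K)) = 0
    generalize (S : geomPoints (W.baseChange K)) = R at h ⊢
    change ((W.baseChange K).baseChange (AlgebraicClosure K)).toAffine.Point at R
    rcases R with _ | ⟨x, y, hxy⟩
    · rfl
    · change WeierstrassCurve.Affine.Point.map (W' := W) (j.symm : (AlgebraicClosure K) →ₐ[ℚ] (AlgebraicClosure ℚ)) (.some x y hxy) = 0 at h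
      rw [WeierstrassCurve.Affine.Point.map_some] at h
      cases h
  -- `τ` acts on `ℚ̄`-points through `g = j⁻¹ τ j ∈ Γ_ℚ`
  let g : absoluteGaloisGroup ℚ := show (AlgebraicClosure ℚ) ≃ₐ[ℚ] (AlgebraicClosure ℚ) from j.trans (hτ.algEquiv.trans j.symm)
  have hg : ∀ x : (AlgebraicClosure ℚ), (show (AlgebraicClosure ℚ) ≃ₐ[ℚ] (AlgebraicClosure ℚ) from g) x = j.symm (τ (j x)) := fun x => rfl
  have hψτ : ∀ S, ψ (hτ.torsionMap W (n : ℤ) S) = g • ψ S := fun S => by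
    apply Subtype.ext
    change φ' (hτ.pointsMap W (S : geomPoints (W.baseChange K))) = g • φ' (S : geomPoints (W.baseChange K))
    generalize (S : geomPoints (W.baseChange K)) = R
    change ((W.baseChange K).baseChange (AlgebraicClosure K)).toAffine.Point at R
    rcases R with _ | ⟨x, y, hxy⟩
    · rfl
    · have hx : j.symm (τ x) = j.symm (τ (j (j.symm x))) := by rw [AlgEquiv.apply_symm_apply]
      have hy : j.symm (τ y) = j.symm (τ (j (j.symm y))) := by rw [AlgEquiv.apply_symm_apply]
      exact Affine.Point.some_eq_some_of_eq hx hy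
  -- the transported Weil pairing `ẽ(S, T) = j (w (ψ S) (ψ T))` and its properties
  let wK : geomTorsion (W.baseChange K) (n : ℤ) → geomTorsion (W.baseChange K) (n : ℤ) → (AlgebraicClosure K) :=
    fun S T => j (w (ψ S) (ψ T))
  have hwKμ : ∀ S T, wK S T ^ n = 1 := fun S T => by
    change j _ ^ n = 1
    rw [← map_pow, hwμ, map_one]
  have hwKadd₁ : ∀ S₁ S₂ T, wK (S₁ + S₂) T = wK S₁ T * wK S₂ T := fun S₁ S₂ T => by
    change j _ = j _ * j _
    rw [← map_mul, hψadd, hwadd₁]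
  have hwKadd₂ : ∀ S T₁ T₂, wK S (T₁ + T₂) = wK S T₁ * wK S T₂ := fun S T₁ T₂ => by
    change j _ = j _ * j _
    rw [← map_mul, hψadd, hwadd₂]
  have hwKalt : ∀ T, wK T T = 1 := fun T => by
    change j _ = 1
    rw [hwalt, map_one]
  have hwKnd : ∀ T, (∀ S, wK S T = 1) → T = 0 := fun T hT => by
    refine hψzero T (hwnd _ fun S' => ?_)
    -- every `S' ∈ E[n](ℚ̄)` is `ψ S` for `S = j S'`
    let φ : geomPoints W →+ geomPoints (W.baseChange K) :=
      WeierstrassCurve.Affine.Point.map (W' := W) (j : (AlgebraicClosure ℚ) →ₐ[ℚ] (AlgebraicClosure K))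
    have hφmem : φ (S' : geomPoints W) ∈ geomTorsion (W.baseChange K) (n : ℤ) := by
      rw [mem_geomTorsion_iff, ← map_zsmul, (mem_geomTorsion_iff _ _ _).1 S'.2, map_zero]
    have hψφ : ψ ⟨φ S', hφmem⟩ = S' := by
      apply Subtype.ext
      change φ' (φ (S' : geomPoints W)) = S'
      generalize (S' : geomPoints W) = R
      change (W.baseChange (AlgebraicClosure ℚ)).toAffine.Point at R
      rcases R with _ | ⟨x, y, hxy⟩
      · rfl
      · exact Affine.Point.some_eq_some_of_eq (j.symm_apply_apply x) (j.symm_apply_apply y)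
    have h := hT ⟨φ S', hφmem⟩
    change j (w (ψ ⟨φ S', hφmem⟩) (ψ T)) = 1 at h
    rw [hψφ] at h
    exact j.injective (h.trans (map_one j).symm)
  have hwKτ : ∀ S T, wK (hτ.torsionMap W (n : ℤ) S) (hτ.torsionMap W (n : ℤ) T) = τ (wK S T) := fun S T => by
    change j (w (ψ _) (ψ _)) = τ (j _)
    rw [hψτ, hψτ, ← hwgal]
    change j ((show (AlgebraicClosure ℚ) ≃ₐ[ℚ] (AlgebraicClosure ℚ) from g) _) = _
    rw [hg, AlgEquiv.apply_symm_apply]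
  -- a frame of `E[n](K̄)`
  have hnK : ((n : ℕ) : K) ≠ 0 := by exact_mod_cast hn0
  obtain ⟨ef⟩ := nonempty_geomTorsion_addEquiv_fin_two (W.baseChange K) (m := n) hnK
  obtain ⟨P, hPdef⟩ : ∃ P : geomTorsion (W.baseChange K) (n : ℤ), P = ef.symm (Pi.single 0 1) := ⟨_, rfl⟩
  obtain ⟨Q, hQdef⟩ : ∃ Q : geomTorsion (W.baseChange K) (n : ℤ), Q = ef.symm (Pi.single 1 1) := ⟨_, rfl⟩
  have heP : ef P = Pi.single 0 1 := by rw [hPdef, ef.apply_symm_apply]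
  have heQ : ef Q = Pi.single 1 1 := by rw [hQdef, ef.apply_symm_apply]
  have h01 : (0 : Fin 2) ≠ 1 := by decide
  have hdecomp : ∀ T : geomTorsion (W.baseChange K) (n : ℤ), T = (ef T 0).val • P + (ef T 1).val • Q :=
      fun T ↦ by
    apply ef.injective
    rw [map_add, map_nsmul, map_nsmul, heP, heQ]
    ext i
    fin_cases i
    · change ef T 0 = ((ef T 0).val • (Pi.single 0 1 : Fin 2 → ZMod n) +
        (ef T 1).val • (Pi.single 1 1 : Fin 2 → ZMod n)) 0
      rw [Pi.add_apply, Pi.smul_apply, Pi.smul_apply, Pi.single_eq_same,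
        Pi.single_eq_of_ne h01, smul_zero, add_zero, nsmul_eq_mul, mul_one, ZMod.natCast_zmod_val]
    · change ef T 1 = ((ef T 0).val • (Pi.single 0 1 : Fin 2 → ZMod n) +
        (ef T 1).val • (Pi.single 1 1 : Fin 2 → ZMod n)) 1
      rw [Pi.add_apply, Pi.smul_apply, Pi.smul_apply, Pi.single_eq_same,
        Pi.single_eq_of_ne h01.symm, smul_zero, zero_add, nsmul_eq_mul, mul_one,
        ZMod.natCast_zmod_val]
  -- non-vanishing of the values
  have hne : ∀ S T, e S T ≠ 0 := fun S T h0 => by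
    have := hμ S T
    rw [h0, zero_pow hn0] at this
    exact zero_ne_one this
  have hwKne : ∀ S T, wK S T ≠ 0 := fun S T h0 => by
    have := hwKμ S T
    rw [h0, zero_pow hn0] at this
    exact zero_ne_one this
  -- `ζ̃ = ẽ(P, Q)` is a primitive `n`-th root of unity
  have hprim : IsPrimitiveRoot (wK P Q) n := by
    refine ⟨hwKμ P Q, fun l hl => ?_⟩
    -- `ẽ(S, l • Q) = 1` for all `S`, hence `l • Q = 0` (non-degeneracy), hence `n ∣ l`
    have hlQ : l • Q = 0 := hwKnd _ fun S => by
      rw [hdecomp S, hwKadd₁, pair_nsmul_left wK hwKadd₁ hwKne, pair_nsmul_left wK hwKadd₁ hwKne,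
        pair_nsmul_right wK hwKadd₂ hwKne, pair_nsmul_right wK hwKadd₂ hwKne, hl, hwKalt Q]
      simp only [one_pow, mul_one]
    have h := congrArg (fun v : Fin 2 → ZMod n => v 1) (map_nsmul ef l Q)
    simp only [hlQ, map_zero, Pi.zero_apply, heQ, Pi.smul_apply, Pi.single_eq_same, nsmul_eq_mul, mul_one] at h
    exact (ZMod.natCast_eq_zero_iff l n).mp h.symm
  -- `e(P, Q) = ζ̃^u`, hence `e = ẽ^u` everywhere
  obtain ⟨u, -, hu⟩ := hprim.eq_pow_of_pow_eq_one (hμ P Q)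
  have hepow : ∀ S T, e S T = wK S T ^ u := fun S T => by
    have h1 := pair_coord e hadd₁ hadd₂ hne halt P Q (ef S 0).val (ef T 0).val (ef S 1).val (ef T 1).val
    have h2 := pair_coord wK hwKadd₁ hwKadd₂ hwKne hwKalt P Q (ef S 0).val (ef T 0).val (ef S 1).val (ef T 1).val
    rw [← hdecomp S, ← hdecomp T] at h1 h2
    rw [← hu, ← pow_mul, ← pow_mul] at h1
    have h3 : wK S T ^ u * wK P Q ^ (u * ((ef T 0).val * (ef S 1).val)) =
        wK P Q ^ (u * ((ef S 0).val * (ef T 1).val)) := by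
      rw [pow_mul' (wK P Q) u ((ef T 0).val * (ef S 1).val), pow_mul' (wK P Q) u ((ef S 0).val * (ef T 1).val),
        ← mul_pow, h2]
    exact mul_right_cancel₀ (pow_ne_zero _ (hwKne P Q)) (h1.trans h3.symm)
  rw [hepow, hepow, hwKτ, map_pow]

end Semilinear

end Summit.BirchSwinnertonDyer.BirchSwinnertonDyer.Theorems.CasselsTateConj

end
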